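import Literature.LinearAlgebra.Alternating.WedgeOneWedgeCalculus
import HarnessLib

/-!
# Graded forms: all degrees at once, with creation/annihilation operators and the shuffle wedge

Topic `Literature/LinearAlgebra/Alternating`. For a real normed space `V` and a normed `ℝ`-space
`F` we package the continuous alternating maps of ALL degrees into one module
`GForm V F = Π_m (V [⋀^Fin m]→L[ℝ] F)` (the device used inside the proof of
`eq_zero_of_iterate_lefschetz_eq_zero`, `LefschetzCAR.lean`), so that the exterior-algebra
operations become honest (degree-free) endomorphisms and the identities of the CAR calculus
(`WedgeOne.lean`) and of the wedge calculus (`WedgeOneWedgeCalculus.lean`) can be composed without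
transporting along equations of degrees:

* `GForm.of k η` — the homogeneous element of degree `k`;
* `wedgeOneG θ` — `θ ∧ ·` (real covector `θ`), `curryLeftG x` — the interior product `x ⌟ ·`,
  with the CAR `x ⌟ (θ ∧ w) = θ(x) w - θ ∧ (x ⌟ w)` (`curryLeftG_wedgeOneG`) and the
  anticommutation relations;
* `lefG θ θ' s = ∑_{a ∈ s} θ_a ∧ θ'_a ∧ ·` — the Lefschetz-type operator of a family of pairs of
  covectors (Voisin (2002), §6.2.1), an element of the ring `Module.End ℝ (GForm V F)`; these commute
  pairwise and with every `wedgeOneG`, the singleton operators square to zero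
  (`lefG_singleton_mul_self`), whence the binomial formula `lefG_insert_pow_succ`;
* `wedgeG` — the shuffle wedge (`ContinuousAlternatingMap.wedge`, values in a normed commutative
  `ℝ`-algebra) extended bilinearly to graded forms; `wedgeG_of_of`; `wedgeG (θ ∧ w) w' = θ ∧ wedgeG w w'`,
  `wedgeG w (θ ∧ w') = θ ∧ wedgeG (negDeg w) w'` (graded commutativity, `negDeg` = the parity
  operator), hence `wedgeG (L w) w' = L (wedgeG w w') = wedgeG w (L w')`;
* `conjG` — complex conjugation of `ℂ`-valued graded forms, `pullG T` — pull-back along a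
  continuous linear map, and their compatibilities with all of the above.

Everything is a definition with a body or a proved identity (Warner (1983), 2.6, 2.10, 2.11).

## References

* F. W. Warner, *Foundations of Differentiable Manifolds and Lie Groups*, GTM 94 (1983), 2.6,
  2.10, 2.11. [Warner1983]
* C. Voisin, *Hodge Theory and Complex Algebraic Geometry I*, CUP (2002), §6.2.1. [Voisin2002]
-/

noncomputable section

open ContinuousAlternatingMap Function Finset
open Literature.Geometry.Kaehler (wedgeOne_wedge_eq wedgeOne_domDomCongr_finCongr
  domDomCongr_finCongr_trans domDomCongr_finCongr_self sum_wedge_left domDomCongr_sum)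

namespace Literature.LinearAlgebra.Alternating

variable {V : Type*} [NormedAddCommGroup V] [NormedSpace ℝ V]
  {F : Type*} [NormedAddCommGroup F] [NormedSpace ℝ F]
  {A : Type*} [NormedCommRing A] [NormedAlgebra ℝ A]

variable (V F) in
/-- **Graded forms**: continuous alternating maps of all degrees on `V` with values in `F`,
`Π_m Λᵐ(V; F)`, with the product module structure. [folklore] -/
abbrev GForm : Type _ := (m : ℕ) → V [⋀^Fin m]→L[ℝ] F

namespace GForm

/-! ### Homogeneous elements -/

/-- The homogeneous graded form of degree `k` with component `η`. [folklore] -/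
def of (k : ℕ) (η : V [⋀^Fin k]→L[ℝ] F) : GForm V F := Pi.single k η

/-- The degree-`k` component of `of k η` is `η`. [folklore] -/
@[simp]
theorem of_apply_self (k : ℕ) (η : V [⋀^Fin k]→L[ℝ] F) : of k η k = η := by
  simp [of]

/-- The other components of `of k η` vanish. [folklore] -/
theorem of_apply_of_ne {k m : ℕ} (h : m ≠ k) (η : V [⋀^Fin k]→L[ℝ] F) : of k η m = 0 := by
  simp [of, h]

/-- `of k` is additive. [folklore] -/
theorem of_add (k : ℕ) (η ψ : V [⋀^Fin k]→L[ℝ] F) : of k (η + ψ) = of k η + of k ψ := by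
  unfold of; exact Pi.single_add (f := fun m ↦ V [⋀^Fin m]→L[ℝ] F) k η ψ

/-- `of k` commutes with scalars. [folklore] -/
theorem of_smul {R : Type*} [Monoid R] [DistribMulAction R F] [ContinuousConstSMul R F]
    [SMulCommClass ℝ R F] (k : ℕ) (c : R) (η : V [⋀^Fin k]→L[ℝ] F) : of k (c • η) = c • of k η := by
  unfold of; exact Pi.single_smul (f := fun m ↦ V [⋀^Fin m]→L[ℝ] F) k c η

/-- `of k 0 = 0`. [folklore] -/
@[simp]
theorem of_zero (k : ℕ) : of k (0 : V [⋀^Fin k]→L[ℝ] F) = 0 := by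
  unfold of; exact Pi.single_zero k

/-- `of k` commutes with negation. [folklore] -/
theorem of_neg (k : ℕ) (η : V [⋀^Fin k]→L[ℝ] F) : of k (-η) = -of k η := by
  unfold of; exact Pi.single_neg (f := fun m ↦ V [⋀^Fin m]→L[ℝ] F) k η

/-- `of k` commutes with subtraction. [folklore] -/
theorem of_sub (k : ℕ) (η ψ : V [⋀^Fin k]→L[ℝ] F) : of k (η - ψ) = of k η - of k ψ := by
  unfold of; exact Pi.single_sub (f := fun m ↦ V [⋀^Fin m]→L[ℝ] F) k η ψ

/-- `of k` commutes with finite sums. [folklore] -/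
theorem of_sum {ι : Type*} (k : ℕ) (s : Finset ι) (η : ι → V [⋀^Fin k]→L[ℝ] F) :
    of k (∑ i ∈ s, η i) = ∑ i ∈ s, of k (η i) := by
  classical
  induction s using Finset.induction_on with
  | empty => rw [sum_empty, sum_empty, of_zero]
  | insert a s ha ih => rw [sum_insert ha, sum_insert ha, of_add, ih]

/-- `of k` is injective. [folklore] -/
theorem of_injective (k : ℕ) : Function.Injective (of (V := V) (F := F) k) := fun η ψ h ↦ by
  have := congrFun h k
  rwa [of_apply_self, of_apply_self] at this

/-- `of k η = 0 ↔ η = 0`. [folklore] -/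
theorem of_eq_zero_iff {k : ℕ} {η : V [⋀^Fin k]→L[ℝ] F} : of k η = 0 ↔ η = 0 := by
  rw [← of_zero k]; exact (of_injective k).eq_iff

/-- Reindexing a component along an equation of degrees gives the same homogeneous graded form.
[folklore] -/
theorem of_domDomCongr_finCongr {k k' : ℕ} (h : k = k') (η : V [⋀^Fin k]→L[ℝ] F) :
    of k' (η.domDomCongr (finCongr h)) = of k η := by
  subst h; rfl

/-! ### The parity operator -/

/-- The **parity operator** `(negDeg w)_m = (-1)^m w_m`. [folklore] -/
def negDeg (w : GForm V F) : GForm V F := fun m ↦ ((-1 : ℝ) ^ m) • w m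

/-- Components of `negDeg`. [folklore] -/
@[simp]
theorem negDeg_apply (w : GForm V F) (m : ℕ) : negDeg w m = ((-1 : ℝ) ^ m) • w m := rfl

/-- `negDeg` is an involution. [folklore] -/
@[simp]
theorem negDeg_negDeg (w : GForm V F) : negDeg (negDeg w) = w := by
  funext m
  rw [negDeg_apply, negDeg_apply, smul_smul, ← mul_pow, neg_one_mul, neg_neg, one_pow, one_smul]

/-- `negDeg` on a homogeneous element. [folklore] -/
theorem negDeg_of (k : ℕ) (η : V [⋀^Fin k]→L[ℝ] F) : negDeg (of k η) = ((-1 : ℝ) ^ k) • of k η := by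
  funext m
  rw [negDeg_apply, Pi.smul_apply]
  rcases eq_or_ne m k with rfl | h
  · rfl
  · rw [of_apply_of_ne h, smul_zero, smul_zero]

/-! ### Creation operators `θ ∧ ·` -/

/-- The degree-`m` component of `θ ∧ ·` on graded forms: `0` in degree `0`, `θ ∧ w_m` in degree
`m + 1`. [folklore] -/
def wedgeOneGc (θ : V →L[ℝ] ℝ) : (m : ℕ) → (GForm V F →ₗ[ℝ] V [⋀^Fin m]→L[ℝ] F)
  | 0 => 0
  | m + 1 => ((wedgeOneL (𝕜' := ℝ) θ : (V [⋀^Fin m]→L[ℝ] F) →L[ℝ] _) :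
      (V [⋀^Fin m]→L[ℝ] F) →ₗ[ℝ] V [⋀^Fin (m + 1)]→L[ℝ] F) ∘ₗ LinearMap.proj m

/-- **The creation operator `θ ∧ ·` on graded forms** (`(θ ∧ w)_{m+1} = θ ∧ w_m`, `(θ ∧ w)_0 = 0`).
[cite: Warner1983, 2.10] -/
def wedgeOneG (θ : V →L[ℝ] ℝ) : Module.End ℝ (GForm V F) := LinearMap.pi (wedgeOneGc θ)

/-- Components of `θ ∧ w` in positive degree. [folklore] -/
@[simp]
theorem wedgeOneG_apply_succ (θ : V →L[ℝ] ℝ) (w : GForm V F) (m : ℕ) :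
    wedgeOneG θ w (m + 1) = wedgeOne θ (w m) := rfl

/-- The degree-`0` component of `θ ∧ w` vanishes. [folklore] -/
@[simp]
theorem wedgeOneG_apply_zero (θ : V →L[ℝ] ℝ) (w : GForm V F) : wedgeOneG θ w 0 = 0 := rfl

/-- `θ ∧ ·` on a homogeneous element. [folklore] -/
theorem wedgeOneG_of (θ : V →L[ℝ] ℝ) (k : ℕ) (η : V [⋀^Fin k]→L[ℝ] F) :
    wedgeOneG θ (of k η) = of (k + 1) (wedgeOne θ η) := by
  funext m
  cases m with
  | zero => rw [wedgeOneG_apply_zero, of_apply_of_ne (by omega)]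
  | succ m =>
    rw [wedgeOneG_apply_succ]
    rcases eq_or_ne m k with rfl | h
    · rw [of_apply_self, of_apply_self]
    · rw [of_apply_of_ne h, of_apply_of_ne (by omega), wedgeOne_zero]

/-- **Anticommutation of creation operators**: `θ ∧ (θ' ∧ w) = -θ' ∧ (θ ∧ w)`.
[cite: Warner1983, 2.6] -/
theorem wedgeOneG_wedgeOneG (θ θ' : V →L[ℝ] ℝ) (w : GForm V F) :
    wedgeOneG θ (wedgeOneG θ' w) = -wedgeOneG θ' (wedgeOneG θ w) := by
  funext m
  match m with
  | 0 => rw [wedgeOneG_apply_zero, Pi.neg_apply, wedgeOneG_apply_zero, neg_zero]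
  | 1 => rw [wedgeOneG_apply_succ, wedgeOneG_apply_zero, wedgeOne_zero, Pi.neg_apply,
      wedgeOneG_apply_succ, wedgeOneG_apply_zero, wedgeOne_zero, neg_zero]
  | m + 2 =>
    rw [Pi.neg_apply, wedgeOneG_apply_succ, wedgeOneG_apply_succ, wedgeOneG_apply_succ,
      wedgeOneG_apply_succ, ← add_eq_zero_iff_eq_neg]
    exact wedgeOne_wedgeOne_add_swap θ θ' (w m)

/-- `θ ∧ (θ ∧ w) = 0`. [cite: Warner1983, 2.6] -/
theorem wedgeOneG_wedgeOneG_self (θ : V →L[ℝ] ℝ) (w : GForm V F) :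
    wedgeOneG θ (wedgeOneG θ w) = 0 := by
  funext m
  match m with
  | 0 => rfl
  | 1 => rw [wedgeOneG_apply_succ, wedgeOneG_apply_zero, wedgeOne_zero]; rfl
  | m + 2 => rw [wedgeOneG_apply_succ, wedgeOneG_apply_succ, wedgeOne_wedgeOne_self]; rfl

/-- The same as an identity in the endomorphism ring. [folklore] -/
theorem wedgeOneG_mul_self (θ : V →L[ℝ] ℝ) :
    (wedgeOneG θ * wedgeOneG θ : Module.End ℝ (GForm V F)) = 0 :=
  LinearMap.ext fun w ↦ wedgeOneG_wedgeOneG_self θ w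

/-- `θ ∧ ·` is additive in `θ`. [folklore] -/
theorem wedgeOneG_add_left (θ θ' : V →L[ℝ] ℝ) (w : GForm V F) :
    wedgeOneG (θ + θ') w = wedgeOneG θ w + wedgeOneG θ' w := by
  funext m
  cases m with
  | zero => rw [Pi.add_apply, wedgeOneG_apply_zero, wedgeOneG_apply_zero, wedgeOneG_apply_zero, add_zero]
  | succ m => rw [Pi.add_apply, wedgeOneG_apply_succ, wedgeOneG_apply_succ, wedgeOneG_apply_succ,
      wedgeOne_add_left]

/-- `θ ∧ ·` is homogeneous in `θ`. [folklore] -/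
theorem wedgeOneG_smul_left (c : ℝ) (θ : V →L[ℝ] ℝ) (w : GForm V F) :
    wedgeOneG (c • θ) w = c • wedgeOneG θ w := by
  funext m
  cases m with
  | zero => rw [Pi.smul_apply, wedgeOneG_apply_zero, wedgeOneG_apply_zero, smul_zero]
  | succ m => rw [Pi.smul_apply, wedgeOneG_apply_succ, wedgeOneG_apply_succ, wedgeOne_smul_left]

/-- `0 ∧ w = 0`. [folklore] -/
theorem wedgeOneG_zero_left (w : GForm V F) : wedgeOneG (0 : V →L[ℝ] ℝ) w = 0 := by
  funext m
  cases m with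
  | zero => rfl
  | succ m =>
    rw [wedgeOneG_apply_succ, Pi.zero_apply]
    ext v; simp [wedgeOne_apply]

/-- `(-θ) ∧ w = -(θ ∧ w)`. [folklore] -/
theorem wedgeOneG_neg_left (θ : V →L[ℝ] ℝ) (w : GForm V F) : wedgeOneG (-θ) w = -wedgeOneG θ w := by
  funext m
  cases m with
  | zero => rw [Pi.neg_apply, wedgeOneG_apply_zero, wedgeOneG_apply_zero, neg_zero]
  | succ m =>
    rw [Pi.neg_apply, wedgeOneG_apply_succ, wedgeOneG_apply_succ]
    ext v; simp [wedgeOne_apply]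

/-- `(θ - θ') ∧ w = θ ∧ w - θ' ∧ w`. [folklore] -/
theorem wedgeOneG_sub_left (θ θ' : V →L[ℝ] ℝ) (w : GForm V F) :
    wedgeOneG (θ - θ') w = wedgeOneG θ w - wedgeOneG θ' w := by
  rw [sub_eq_add_neg, wedgeOneG_add_left, wedgeOneG_neg_left, ← sub_eq_add_neg]

/-! ### Annihilation operators `x ⌟ ·` -/

/-- **The annihilation operator `x ⌟ ·` on graded forms**, `(x ⌟ w)_m = x ⌟ w_{m+1}`
(`curryLeft`). [cite: Warner1983, 2.11] -/
def curryLeftG (x : V) : Module.End ℝ (GForm V F) :=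
  LinearMap.pi fun m ↦
    ((curryLeftL (𝕜' := ℝ) x : (V [⋀^Fin (m + 1)]→L[ℝ] F) →L[ℝ] _) :
      (V [⋀^Fin (m + 1)]→L[ℝ] F) →ₗ[ℝ] V [⋀^Fin m]→L[ℝ] F) ∘ₗ LinearMap.proj (m + 1)

/-- Components of `x ⌟ w`. [folklore] -/
@[simp]
theorem curryLeftG_apply (x : V) (w : GForm V F) (m : ℕ) :
    curryLeftG x w m = (w (m + 1)).curryLeft x := rfl

/-- `x ⌟ ·` on a homogeneous element of positive degree. [folklore] -/
theorem curryLeftG_of_succ (x : V) (k : ℕ) (η : V [⋀^Fin (k + 1)]→L[ℝ] F) :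
    curryLeftG x (of (k + 1) η) = of k (η.curryLeft x) := by
  funext m
  rw [curryLeftG_apply]
  rcases eq_or_ne m k with rfl | h
  · rw [of_apply_self, of_apply_self]
  · rw [of_apply_of_ne h, of_apply_of_ne (by omega), ContinuousAlternatingMap.curryLeft_zero]
    rfl

/-- `x ⌟ ·` kills homogeneous elements of degree `0`. [folklore] -/
theorem curryLeftG_of_zero (x : V) (η : V [⋀^Fin 0]→L[ℝ] F) : curryLeftG x (of 0 η) = 0 := by
  funext m
  rw [curryLeftG_apply, of_apply_of_ne (by omega), ContinuousAlternatingMap.curryLeft_zero]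
  rfl

/-- **Anticommutation of annihilation operators**: `y ⌟ (x ⌟ w) = -x ⌟ (y ⌟ w)`. [folklore] -/
theorem curryLeftG_curryLeftG (x y : V) (w : GForm V F) :
    curryLeftG y (curryLeftG x w) = -curryLeftG x (curryLeftG y w) := by
  funext m
  rw [Pi.neg_apply, curryLeftG_apply, curryLeftG_apply, curryLeftG_apply, curryLeftG_apply]
  exact curryLeft_curryLeft_swap (w (m + 2)) x y

/-- `x ⌟ (x ⌟ w) = 0`. [folklore] -/
theorem curryLeftG_curryLeftG_self (x : V) (w : GForm V F) : curryLeftG x (curryLeftG x w) = 0 := by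
  funext m
  rw [curryLeftG_apply, curryLeftG_apply]
  exact ContinuousAlternatingMap.curryLeft_same (w (m + 2)) x

/-- `x ⌟ ·` is additive in `x`. [folklore] -/
theorem curryLeftG_add_left (x y : V) (w : GForm V F) :
    curryLeftG (x + y) w = curryLeftG x w + curryLeftG y w := by
  funext m
  rw [Pi.add_apply, curryLeftG_apply, curryLeftG_apply, curryLeftG_apply, map_add]

/-- `x ⌟ ·` is homogeneous in `x`. [folklore] -/
theorem curryLeftG_smul_left (c : ℝ) (x : V) (w : GForm V F) :
    curryLeftG (c • x) w = c • curryLeftG x w := by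
  funext m
  rw [Pi.smul_apply, curryLeftG_apply, curryLeftG_apply, map_smul]

/-- `x ⌟ ·` is compatible with negation in `x`. [folklore] -/
theorem curryLeftG_neg_left (x : V) (w : GForm V F) : curryLeftG (-x) w = -curryLeftG x w := by
  funext m
  rw [Pi.neg_apply, curryLeftG_apply, curryLeftG_apply, map_neg]

/-- `x ⌟ ·` is compatible with subtraction in `x`. [folklore] -/
theorem curryLeftG_sub_left (x y : V) (w : GForm V F) :
    curryLeftG (x - y) w = curryLeftG x w - curryLeftG y w := by
  rw [sub_eq_add_neg, curryLeftG_add_left, curryLeftG_neg_left, ← sub_eq_add_neg]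

/-- `(∑ᵢ cᵢ xᵢ) ⌟ w = ∑ᵢ cᵢ (xᵢ ⌟ w)`. [folklore] -/
theorem curryLeftG_sum_smul_left {ι : Type*} (s : Finset ι) (c : ι → ℝ) (x : ι → V) (w : GForm V F) :
    curryLeftG (∑ i ∈ s, c i • x i) w = ∑ i ∈ s, c i • curryLeftG (x i) w := by
  classical
  induction s using Finset.induction_on with
  | empty =>
    rw [sum_empty, sum_empty]
    funext m
    rw [curryLeftG_apply, Pi.zero_apply]; exact map_zero _
  | insert a s ha ih => rw [sum_insert ha, sum_insert ha, curryLeftG_add_left, curryLeftG_smul_left, ih]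

/-- **The canonical anticommutation relation** `x ⌟ (θ ∧ w) = θ(x) w - θ ∧ (x ⌟ w)`
(Warner (1983), 2.11: `x ⌟` is an antiderivation). [cite: Warner1983, 2.11] -/
theorem curryLeftG_wedgeOneG (x : V) (θ : V →L[ℝ] ℝ) (w : GForm V F) :
    curryLeftG x (wedgeOneG θ w) = θ x • w - wedgeOneG θ (curryLeftG x w) := by
  funext m
  rw [curryLeftG_apply, wedgeOneG_apply_succ, Pi.sub_apply, Pi.smul_apply]
  cases m with
  | zero => rw [wedgeOneG_apply_zero, sub_zero, curryLeft_wedgeOne_zero]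
  | succ m => rw [wedgeOneG_apply_succ, curryLeftG_apply, curryLeft_wedgeOne]

/-! ### Lefschetz-type operators -/

section Lefschetz

variable {ι : Type*} (θ θ' : ι → V →L[ℝ] ℝ)

/-- **The Lefschetz-type operator** `L_s = ∑_{a ∈ s} θ_a ∧ θ'_a ∧ ·` of a family of pairs of real
covectors, on graded forms (for a unitary coframe and `s = univ` this is `ω ∧ ·`, the Lefschetz
operator `L`; Voisin (2002), §6.2.1). [cite: Voisin2002, §6.2.1] -/
def lefG (s : Finset ι) : Module.End ℝ (GForm V F) := ∑ a ∈ s, wedgeOneG (θ a) * wedgeOneG (θ' a)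

/-- Unfolding of `lefG`. [folklore] -/
theorem lefG_apply (s : Finset ι) (w : GForm V F) :
    lefG θ θ' s w = ∑ a ∈ s, wedgeOneG (θ a) (wedgeOneG (θ' a) w) := by
  simp only [lefG, LinearMap.coe_sum, Finset.sum_apply, Module.End.mul_apply]

/-- Components of `L_s w` in degrees `≥ 2`. [folklore] -/
theorem lefG_apply_add_two (s : Finset ι) (w : GForm V F) (m : ℕ) :
    lefG θ θ' s w (m + 2) = ∑ a ∈ s, wedgeOne (θ a) (wedgeOne (θ' a) (w m)) := by
  rw [lefG_apply, Finset.sum_apply]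
  rfl

/-- The degree-`0` component of `L_s w` vanishes. [folklore] -/
@[simp]
theorem lefG_apply_zero (s : Finset ι) (w : GForm V F) : lefG θ θ' s w 0 = 0 := by
  rw [lefG_apply, Finset.sum_apply]
  exact Finset.sum_eq_zero fun a _ ↦ rfl

/-- The degree-`1` component of `L_s w` vanishes. [folklore] -/
@[simp]
theorem lefG_apply_one (s : Finset ι) (w : GForm V F) : lefG θ θ' s w 1 = 0 := by
  rw [lefG_apply, Finset.sum_apply]
  exact Finset.sum_eq_zero fun a _ ↦ by
    rw [wedgeOneG_apply_succ, wedgeOneG_apply_zero, wedgeOne_zero]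

/-- `L_s` on a homogeneous element. [folklore] -/
theorem lefG_of (s : Finset ι) (k : ℕ) (η : V [⋀^Fin k]→L[ℝ] F) :
    lefG θ θ' s (of k η) = of (k + 2) (∑ a ∈ s, wedgeOne (θ a) (wedgeOne (θ' a) η)) := by
  rw [lefG_apply, of_sum]
  exact Finset.sum_congr rfl fun a _ ↦ by rw [wedgeOneG_of, wedgeOneG_of]

/-- `L_s` is additive in the index set. [folklore] -/
theorem lefG_insert [DecidableEq ι] {s : Finset ι} {a : ι} (ha : a ∉ s) :
    (lefG θ θ' (insert a s) : Module.End ℝ (GForm V F)) = lefG θ θ' {a} + lefG θ θ' s := by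
  rw [lefG, lefG, lefG, Finset.sum_insert ha, Finset.sum_singleton]

/-- `L_∅ = 0`. [folklore] -/
@[simp]
theorem lefG_empty : (lefG θ θ' ∅ : Module.End ℝ (GForm V F)) = 0 := Finset.sum_empty

/-- The singleton operator is `θ_a ∧ θ'_a ∧ ·`. [folklore] -/
theorem lefG_singleton_apply (a : ι) (w : GForm V F) :
    lefG θ θ' {a} w = wedgeOneG (θ a) (wedgeOneG (θ' a) w) := by
  rw [lefG_apply, Finset.sum_singleton]

/-- **`L_s` commutes with every creation operator** (pairs of covectors are central).
[cite: Warner1983, 2.6] -/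
theorem lefG_wedgeOneG (s : Finset ι) (ξ : V →L[ℝ] ℝ) (w : GForm V F) :
    lefG θ θ' s (wedgeOneG ξ w) = wedgeOneG ξ (lefG θ θ' s w) := by
  rw [lefG_apply, lefG_apply, _root_.map_sum]
  exact Finset.sum_congr rfl fun a _ ↦ by
    rw [wedgeOneG_wedgeOneG (θ' a) ξ, map_neg, wedgeOneG_wedgeOneG (θ a) ξ, neg_neg]

/-- The same in the endomorphism ring. [folklore] -/
theorem commute_lefG_wedgeOneG (s : Finset ι) (ξ : V →L[ℝ] ℝ) :
    Commute (lefG θ θ' s : Module.End ℝ (GForm V F)) (wedgeOneG ξ) :=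
  LinearMap.ext fun w ↦ lefG_wedgeOneG θ θ' s ξ w

/-- **Lefschetz-type operators commute.** [cite: Warner1983, 2.6] -/
theorem commute_lefG (s t : Finset ι) :
    Commute (lefG θ θ' s : Module.End ℝ (GForm V F)) (lefG θ θ' t) := by
  refine LinearMap.ext fun w ↦ ?_
  rw [Module.End.mul_apply, Module.End.mul_apply, lefG_apply θ θ' t, lefG_apply θ θ' t, _root_.map_sum]
  exact Finset.sum_congr rfl fun a _ ↦ by rw [lefG_wedgeOneG, lefG_wedgeOneG]

/-- **The singleton operator squares to zero**: `θ_a ∧ θ'_a ∧ θ_a ∧ θ'_a ∧ w = 0`.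
[cite: Warner1983, 2.6] -/
theorem lefG_singleton_mul_self (a : ι) :
    (lefG θ θ' {a} * lefG θ θ' {a} : Module.End ℝ (GForm V F)) = 0 := by
  refine LinearMap.ext fun w ↦ ?_
  rw [Module.End.mul_apply, lefG_singleton_apply, lefG_singleton_apply,
    wedgeOneG_wedgeOneG (θ' a) (θ a), map_neg, wedgeOneG_wedgeOneG_self, neg_zero, LinearMap.zero_apply]

/-- The singleton operator kills forms already divisible by `θ_a`. [cite: Warner1983, 2.6] -/
theorem lefG_singleton_wedgeOneG_fst (a : ι) (w : GForm V F) :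
    lefG θ θ' {a} (wedgeOneG (θ a) w) = 0 := by
  rw [lefG_wedgeOneG, lefG_singleton_apply, wedgeOneG_wedgeOneG_self]

/-- The singleton operator kills forms already divisible by `θ'_a`. [cite: Warner1983, 2.6] -/
theorem lefG_singleton_wedgeOneG_snd (a : ι) (w : GForm V F) :
    lefG θ θ' {a} (wedgeOneG (θ' a) w) = 0 := by
  rw [lefG_singleton_apply, wedgeOneG_wedgeOneG_self, _root_.map_zero]

/-- **Binomial formula with a square-zero summand**: in a ring, if `x` and `y` commute and
`x² = 0`, then `(x + y)^{r+1} = y^{r+1} + (r + 1) x y^r`. [folklore] -/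
theorem _root_.Commute.add_pow_succ_of_sq_eq_zero {R : Type*} [Ring R] {x y : R} (hxy : Commute x y)
    (hx : x * x = 0) (r : ℕ) : (x + y) ^ (r + 1) = y ^ (r + 1) + (r + 1) • (x * y ^ r) := by
  induction r with
  | zero => rw [zero_add, pow_one, pow_one, pow_zero, mul_one, one_smul, add_comm]
  | succ r ih =>
    rw [pow_succ, ih, add_mul, mul_add, mul_add, smul_mul_assoc, smul_mul_assoc]
    have h1 : y ^ (r + 1) * x = x * y ^ (r + 1) := (hxy.pow_right (r + 1)).eq.symm
    have h2 : x * y ^ r * x = 0 := by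
      rw [mul_assoc, ← (hxy.pow_right r).eq, ← mul_assoc, hx, zero_mul]
    have h3 : x * y ^ r * y = x * y ^ (r + 1) := by rw [mul_assoc, ← pow_succ]
    rw [h1, h2, h3, smul_zero, zero_add, ← pow_succ, succ_nsmul _ (r + 1)]
    abel

/-- **The iterates of `L_{insert a s}`**: for `a ∉ s`,
`L_{insert a s}^{r+1} = L_s^{r+1} + (r + 1) L_{a} L_s^r`. [folklore] -/
theorem lefG_insert_pow_succ [DecidableEq ι] {s : Finset ι} {a : ι} (ha : a ∉ s) (r : ℕ) :
    (lefG θ θ' (insert a s) ^ (r + 1) : Module.End ℝ (GForm V F)) =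
      lefG θ θ' s ^ (r + 1) + (r + 1) • (lefG θ θ' {a} * lefG θ θ' s ^ r) := by
  rw [lefG_insert θ θ' ha]
  exact (commute_lefG θ θ' {a} s).add_pow_succ_of_sq_eq_zero (lefG_singleton_mul_self θ θ' a) r

/-- Powers of `L_s` commute with every creation operator. [folklore] -/
theorem lefG_pow_wedgeOneG (s : Finset ι) (r : ℕ) (ξ : V →L[ℝ] ℝ) (w : GForm V F) :
    (lefG θ θ' s ^ r) (wedgeOneG ξ w) = wedgeOneG ξ ((lefG θ θ' s ^ r) w) := by
  have h := (commute_lefG_wedgeOneG (F := F) θ θ' s ξ).pow_left r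
  exact LinearMap.congr_fun h.eq w

/-- Components of `L_s^r w` below degree `2r` vanish... in the form needed: the degree-`0` and
degree-`1` components of `L_s^{r+1} w` vanish. [folklore] -/
theorem lefG_pow_succ_apply_zero (s : Finset ι) (r : ℕ) (w : GForm V F) :
    (lefG θ θ' s ^ (r + 1)) w 0 = 0 := by
  rw [pow_succ', Module.End.mul_apply, lefG_apply_zero]

/-- The degree-`1` component of `L_s^{r+1} w` vanishes. [folklore] -/
theorem lefG_pow_succ_apply_one (s : Finset ι) (r : ℕ) (w : GForm V F) :
    (lefG θ θ' s ^ (r + 1)) w 1 = 0 := by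
  rw [pow_succ', Module.End.mul_apply, lefG_apply_one]

/-- **`L_s^r` on a homogeneous element is homogeneous of degree `k + 2r`**: its components in
other degrees vanish. [folklore] -/
theorem lefG_pow_of_apply_of_ne (s : Finset ι) (r : ℕ) {k m : ℕ} (h : m ≠ k + 2 * r)
    (η : V [⋀^Fin k]→L[ℝ] F) : (lefG θ θ' s ^ r) (of k η) m = 0 := by
  induction r generalizing m with
  | zero => rw [pow_zero, Module.End.one_apply, of_apply_of_ne (by simpa using h)]
  | succ r ih =>
    rw [pow_succ', Module.End.mul_apply]
    match m with
    | 0 => exact lefG_apply_zero θ θ' s _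
    | 1 => exact lefG_apply_one θ θ' s _
    | m + 2 =>
      rw [lefG_apply_add_two, ih (by omega)]
      exact Finset.sum_eq_zero fun a _ ↦ by rw [wedgeOne_zero, wedgeOne_zero]

/-- `L_s^r (of k η)` is the homogeneous element of degree `k + 2r` on its own component. [folklore] -/
theorem lefG_pow_of_eq_of (s : Finset ι) (r : ℕ) (k : ℕ) (η : V [⋀^Fin k]→L[ℝ] F) :
    (lefG θ θ' s ^ r) (of k η) = of (k + 2 * r) ((lefG θ θ' s ^ r) (of k η) (k + 2 * r)) := by
  funext m
  rcases eq_or_ne m (k + 2 * r) with rfl | h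
  · rw [of_apply_self]
  · rw [of_apply_of_ne h, lefG_pow_of_apply_of_ne θ θ' s r h]

end Lefschetz

/-! ### Pull-back along a continuous linear map -/

section Pull

variable {W : Type*} [NormedAddCommGroup W] [NormedSpace ℝ W]

/-- **Pull-back of graded forms** along a continuous linear map `T : W → V`, componentwise
`(T^* w)_m = w_m ∘ T`. [folklore] -/
def pullG (T : W →L[ℝ] V) : GForm V F →ₗ[ℝ] GForm W F where
  toFun w m := (w m).compContinuousLinearMap T
  map_add' w w' := funext fun m ↦ by ext v; simp
  map_smul' c w := funext fun m ↦ by ext v; simp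

/-- Components of the pull-back. [folklore] -/
@[simp]
theorem pullG_apply (T : W →L[ℝ] V) (w : GForm V F) (m : ℕ) :
    pullG T w m = (w m).compContinuousLinearMap T := rfl

/-- Pull-back of a homogeneous element. [folklore] -/
theorem pullG_of (T : W →L[ℝ] V) (k : ℕ) (η : V [⋀^Fin k]→L[ℝ] F) :
    pullG T (of k η) = of k (η.compContinuousLinearMap T) := by
  funext m
  rw [pullG_apply]
  rcases eq_or_ne m k with rfl | h
  · rw [of_apply_self, of_apply_self]
  · rw [of_apply_of_ne h, of_apply_of_ne h]; ext v; simp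

/-- **Pull-back of a wedge with a covector**: `T^*(θ ∧ w) = (θ ∘ T) ∧ T^* w`.
[cite: Warner1983, 2.22] -/
theorem pullG_wedgeOneG (T : W →L[ℝ] V) (θ : V →L[ℝ] ℝ) (w : GForm V F) :
    pullG T (wedgeOneG θ w) = wedgeOneG (θ.comp T) (pullG T w) := by
  funext m
  cases m with
  | zero => rw [pullG_apply, wedgeOneG_apply_zero, wedgeOneG_apply_zero]; ext v; simp
  | succ m =>
    rw [pullG_apply, wedgeOneG_apply_succ, wedgeOneG_apply_succ, pullG_apply]
    ext v
    simp only [compContinuousLinearMap_apply, wedgeOne_apply, ContinuousLinearMap.comp_apply, comp_apply]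
    rfl

/-- Pull-back along an endomorphism and interior products: `x ⌟ T^* w = T^* (T x ⌟ w)`. [folklore] -/
theorem curryLeftG_pullG (T : W →L[ℝ] V) (x : W) (w : GForm V F) :
    curryLeftG x (pullG T w) = pullG T (curryLeftG (T x) w) := by
  funext m
  rw [curryLeftG_apply, pullG_apply, pullG_apply, curryLeftG_apply]
  exact ContinuousAlternatingMap.curryLeft_compContinuousLinearMap (w (m + 1)) T x

end Pull

/-! ### Complex conjugation of `ℂ`-valued graded forms -/

section Conj

/-- **Complex conjugation of `ℂ`-valued graded forms**, componentwise `conjForm`. [folklore] -/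
def conjG (w : GForm V ℂ) : GForm V ℂ := fun m ↦ conjForm (w m)

/-- Components of the conjugate. [folklore] -/
@[simp]
theorem conjG_apply (w : GForm V ℂ) (m : ℕ) : conjG w m = conjForm (w m) := rfl

/-- Conjugation is an involution. [folklore] -/
@[simp]
theorem conjG_conjG (w : GForm V ℂ) : conjG (conjG w) = w := by
  funext m; rw [conjG_apply, conjG_apply, conj_conj]

/-- Conjugation is additive. [folklore] -/
theorem conjG_add (w w' : GForm V ℂ) : conjG (w + w') = conjG w + conjG w' := by
  funext m; exact conj_add (w m) (w' m)

/-- Conjugation commutes with subtraction. [folklore] -/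
theorem conjG_sub (w w' : GForm V ℂ) : conjG (w - w') = conjG w - conjG w' := by
  funext m; exact conj_sub (w m) (w' m)

/-- Conjugation commutes with negation. [folklore] -/
theorem conjG_neg (w : GForm V ℂ) : conjG (-w) = -conjG w := by
  funext m; exact conj_neg (w m)

/-- Conjugation of `0`. [folklore] -/
@[simp]
theorem conjG_zero : conjG (0 : GForm V ℂ) = 0 := by
  funext m; exact conj_zero

/-- A graded form vanishes iff its conjugate does. [folklore] -/
theorem conjG_eq_zero_iff {w : GForm V ℂ} : conjG w = 0 ↔ w = 0 := by
  refine ⟨fun h ↦ ?_, fun h ↦ by rw [h, conjG_zero]⟩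
  rw [← conjG_conjG w, h, conjG_zero]

/-- Conjugation is conjugate-linear. [folklore] -/
theorem conjG_smul (c : ℂ) (w : GForm V ℂ) : conjG (c • w) = starRingEnd ℂ c • conjG w := by
  funext m; exact conj_smul c (w m)

/-- Conjugation commutes with real scalars. [folklore] -/
theorem conjG_smul_real (c : ℝ) (w : GForm V ℂ) : conjG (c • w) = c • conjG w := by
  funext m; exact conj_smul_real c (w m)

/-- Conjugation commutes with finite sums. [folklore] -/
theorem conjG_sum {ι : Type*} (s : Finset ι) (w : ι → GForm V ℂ) :
    conjG (∑ i ∈ s, w i) = ∑ i ∈ s, conjG (w i) := by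
  funext m
  rw [conjG_apply, Finset.sum_apply, Finset.sum_apply, conj_sum]
  rfl

/-- Conjugation of a homogeneous element. [folklore] -/
theorem conjG_of (k : ℕ) (η : V [⋀^Fin k]→L[ℝ] ℂ) : conjG (of k η) = of k (conjForm η) := by
  funext m
  rw [conjG_apply]
  rcases eq_or_ne m k with rfl | h
  · rw [of_apply_self, of_apply_self]
  · rw [of_apply_of_ne h, of_apply_of_ne h, conj_zero]

/-- Conjugation commutes with the creation operators (real covectors). [folklore] -/
theorem conjG_wedgeOneG (θ : V →L[ℝ] ℝ) (w : GForm V ℂ) :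
    conjG (wedgeOneG θ w) = wedgeOneG θ (conjG w) := by
  funext m
  cases m with
  | zero => rw [conjG_apply, wedgeOneG_apply_zero, wedgeOneG_apply_zero, conj_zero]
  | succ m => rw [conjG_apply, wedgeOneG_apply_succ, wedgeOneG_apply_succ, conj_wedgeOne, conjG_apply]

/-- Conjugation commutes with the annihilation operators. [folklore] -/
theorem conjG_curryLeftG (x : V) (w : GForm V ℂ) :
    conjG (curryLeftG x w) = curryLeftG x (conjG w) := by
  funext m
  rw [conjG_apply, curryLeftG_apply, curryLeftG_apply, conj_curryLeft, conjG_apply]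

/-- Conjugation commutes with the Lefschetz-type operators. [folklore] -/
theorem conjG_lefG {ι : Type*} (θ θ' : ι → V →L[ℝ] ℝ) (s : Finset ι) (w : GForm V ℂ) :
    conjG (lefG θ θ' s w) = lefG θ θ' s (conjG w) := by
  rw [lefG_apply, lefG_apply, conjG_sum]
  exact Finset.sum_congr rfl fun a _ ↦ by rw [conjG_wedgeOneG, conjG_wedgeOneG]

/-- Conjugation commutes with the powers of the Lefschetz-type operators. [folklore] -/
theorem conjG_lefG_pow {ι : Type*} (θ θ' : ι → V →L[ℝ] ℝ) (s : Finset ι) (r : ℕ) (w : GForm V ℂ) :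
    conjG ((lefG θ θ' s ^ r) w) = (lefG θ θ' s ^ r) (conjG w) := by
  induction r generalizing w with
  | zero => rfl
  | succ r ih => rw [pow_succ, Module.End.mul_apply, Module.End.mul_apply, ih, conjG_lefG]

/-- Conjugation commutes with pull-backs. [folklore] -/
theorem conjG_pullG {W : Type*} [NormedAddCommGroup W] [NormedSpace ℝ W] (T : W →L[ℝ] V)
    (w : GForm V ℂ) : conjG (pullG T w) = pullG T (conjG w) := by
  funext m; ext v; rfl

/-- Real scalars act on `ℂ`-valued graded forms through `ℝ ⊆ ℂ`. [folklore] -/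
theorem coe_real_smul (r : ℝ) (w : GForm V ℂ) : (r : ℂ) • w = r • w := by
  funext m; ext v; simp

/-- The creation operators are `ℂ`-linear on `ℂ`-valued graded forms. [folklore] -/
theorem wedgeOneG_smul_complex (θ : V →L[ℝ] ℝ) (c : ℂ) (w : GForm V ℂ) :
    wedgeOneG θ (c • w) = c • wedgeOneG θ w := by
  funext m
  cases m with
  | zero => rw [Pi.smul_apply, wedgeOneG_apply_zero, wedgeOneG_apply_zero, smul_zero]
  | succ m => rw [Pi.smul_apply, wedgeOneG_apply_succ, wedgeOneG_apply_succ, Pi.smul_apply,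
      wedgeOne_smul_complex]

/-- The annihilation operators are `ℂ`-linear on `ℂ`-valued graded forms. [folklore] -/
theorem curryLeftG_smul_complex (x : V) (c : ℂ) (w : GForm V ℂ) :
    curryLeftG x (c • w) = c • curryLeftG x w := by
  funext m
  rw [Pi.smul_apply, curryLeftG_apply, curryLeftG_apply, Pi.smul_apply, curryLeft_smul']

/-- The Lefschetz-type operators are `ℂ`-linear on `ℂ`-valued graded forms. [folklore] -/
theorem lefG_smul_complex {ι : Type*} (θ θ' : ι → V →L[ℝ] ℝ) (s : Finset ι) (c : ℂ) (w : GForm V ℂ) :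
    lefG θ θ' s (c • w) = c • lefG θ θ' s w := by
  rw [lefG_apply, lefG_apply, Finset.smul_sum]
  exact Finset.sum_congr rfl fun a _ ↦ by rw [wedgeOneG_smul_complex, wedgeOneG_smul_complex]

/-- The powers of the Lefschetz-type operators are `ℂ`-linear on `ℂ`-valued graded forms.
[folklore] -/
theorem lefG_pow_smul_complex {ι : Type*} (θ θ' : ι → V →L[ℝ] ℝ) (s : Finset ι) (r : ℕ) (c : ℂ)
    (w : GForm V ℂ) : (lefG θ θ' s ^ r) (c • w) = c • (lefG θ θ' s ^ r) w := by
  induction r generalizing w with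
  | zero => rfl
  | succ r ih => rw [pow_succ, Module.End.mul_apply, Module.End.mul_apply, lefG_smul_complex, ih]

/-- Pull-back is `ℂ`-linear on `ℂ`-valued graded forms. [folklore] -/
theorem pullG_smul_complex {W : Type*} [NormedAddCommGroup W] [NormedSpace ℝ W] (T : W →L[ℝ] V)
    (c : ℂ) (w : GForm V ℂ) : pullG T (c • w) = c • pullG T w := by
  funext m; ext v; rfl

end Conj

/-! ### The shuffle wedge on graded forms -/

section Wedge

/-- **The shuffle wedge of graded forms** with values in a normed commutative `ℝ`-algebra:
`(w ∧ w')_n = ∑_{k + l = n} w_k ∧ w'_l` (the tree's `ContinuousAlternatingMap.wedge`, Warner's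
normalisation, each summand transported along `k + l = n`). [cite: Warner1983, 2.10] -/
def wedgeG (w w' : GForm V A) : GForm V A := fun n ↦
  ∑ p ∈ antidiagonal n,
    if h : p.1 + p.2 = n then ((w p.1).wedge (w' p.2)).domDomCongr (finCongr h) else 0

/-- Components of the shuffle wedge of graded forms. [folklore] -/
theorem wedgeG_apply (w w' : GForm V A) (n : ℕ) :
    wedgeG w w' n = ∑ p ∈ antidiagonal n,
      if h : p.1 + p.2 = n then ((w p.1).wedge (w' p.2)).domDomCongr (finCongr h) else 0 := rfl

/-- The summand of `wedgeG` at an index of the antidiagonal. [folklore] -/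
theorem wedgeG_summand {w w' : GForm V A} {n : ℕ} {p : ℕ × ℕ} (h : p.1 + p.2 = n) :
    (if h : p.1 + p.2 = n then ((w p.1).wedge (w' p.2)).domDomCongr (finCongr h) else 0) =
      ((w p.1).wedge (w' p.2)).domDomCongr (finCongr h) := by
  rw [dif_pos h]

/-- The shuffle wedge of graded forms is additive on the left. [folklore] -/
theorem wedgeG_add_left (w₁ w₂ w' : GForm V A) : wedgeG (w₁ + w₂) w' = wedgeG w₁ w' + wedgeG w₂ w' := by
  funext n
  rw [Pi.add_apply, wedgeG_apply, wedgeG_apply, wedgeG_apply, ← sum_add_distrib]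
  refine sum_congr rfl fun p hp ↦ ?_
  have h : p.1 + p.2 = n := mem_antidiagonal.1 hp
  rw [dif_pos h, dif_pos h, dif_pos h, Pi.add_apply, ContinuousAlternatingMap.wedge_add_left,
    ContinuousAlternatingMap.domDomCongr_add]

/-- The shuffle wedge of graded forms is additive on the right. [folklore] -/
theorem wedgeG_add_right (w w₁ w₂ : GForm V A) : wedgeG w (w₁ + w₂) = wedgeG w w₁ + wedgeG w w₂ := by
  funext n
  rw [Pi.add_apply, wedgeG_apply, wedgeG_apply, wedgeG_apply, ← sum_add_distrib]
  refine sum_congr rfl fun p hp ↦ ?_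
  have h : p.1 + p.2 = n := mem_antidiagonal.1 hp
  rw [dif_pos h, dif_pos h, dif_pos h, Pi.add_apply, ContinuousAlternatingMap.wedge_add_right,
    ContinuousAlternatingMap.domDomCongr_add]

/-- The shuffle wedge of graded forms commutes with real scalars on the left. [folklore] -/
theorem wedgeG_smul_left (c : ℝ) (w w' : GForm V A) : wedgeG (c • w) w' = c • wedgeG w w' := by
  funext n
  rw [Pi.smul_apply, wedgeG_apply, wedgeG_apply, smul_sum]
  refine sum_congr rfl fun p hp ↦ ?_
  have h : p.1 + p.2 = n := mem_antidiagonal.1 hp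
  rw [dif_pos h, dif_pos h, Pi.smul_apply, ContinuousAlternatingMap.wedge_smul_left,
    domDomCongr_finCongr_smul]

/-- The shuffle wedge of graded forms commutes with real scalars on the right. [folklore] -/
theorem wedgeG_smul_right (c : ℝ) (w w' : GForm V A) : wedgeG w (c • w') = c • wedgeG w w' := by
  funext n
  rw [Pi.smul_apply, wedgeG_apply, wedgeG_apply, smul_sum]
  refine sum_congr rfl fun p hp ↦ ?_
  have h : p.1 + p.2 = n := mem_antidiagonal.1 hp
  rw [dif_pos h, dif_pos h, Pi.smul_apply, ContinuousAlternatingMap.wedge_smul_right,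
    domDomCongr_finCongr_smul]

/-- `0 ∧ w' = 0`. [folklore] -/
@[simp]
theorem wedgeG_zero_left (w' : GForm V A) : wedgeG 0 w' = 0 := by
  have h := wedgeG_smul_left (0 : ℝ) (0 : GForm V A) w'
  rwa [zero_smul, zero_smul] at h

/-- `w ∧ 0 = 0`. [folklore] -/
@[simp]
theorem wedgeG_zero_right (w : GForm V A) : wedgeG w 0 = 0 := by
  have h := wedgeG_smul_right (0 : ℝ) w (0 : GForm V A)
  rwa [zero_smul, zero_smul] at h

/-- `(-w) ∧ w' = -(w ∧ w')`. [folklore] -/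
theorem wedgeG_neg_left (w w' : GForm V A) : wedgeG (-w) w' = -wedgeG w w' := by
  have h := wedgeG_smul_left (-1 : ℝ) w w'
  rwa [neg_one_smul, neg_one_smul] at h

/-- `w ∧ (-w') = -(w ∧ w')`. [folklore] -/
theorem wedgeG_neg_right (w w' : GForm V A) : wedgeG w (-w') = -wedgeG w w' := by
  have h := wedgeG_smul_right (-1 : ℝ) w w'
  rwa [neg_one_smul, neg_one_smul] at h

/-- `(w₁ - w₂) ∧ w' = w₁ ∧ w' - w₂ ∧ w'`. [folklore] -/
theorem wedgeG_sub_left (w₁ w₂ w' : GForm V A) : wedgeG (w₁ - w₂) w' = wedgeG w₁ w' - wedgeG w₂ w' := by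
  rw [sub_eq_add_neg, wedgeG_add_left, wedgeG_neg_left, ← sub_eq_add_neg]

/-- `w ∧ (w₁ - w₂) = w ∧ w₁ - w ∧ w₂`. [folklore] -/
theorem wedgeG_sub_right (w w₁ w₂ : GForm V A) : wedgeG w (w₁ - w₂) = wedgeG w w₁ - wedgeG w w₂ := by
  rw [sub_eq_add_neg, wedgeG_add_right, wedgeG_neg_right, ← sub_eq_add_neg]

/-- The shuffle wedge of graded forms commutes with finite sums on the left. [folklore] -/
theorem wedgeG_sum_left {ι : Type*} (s : Finset ι) (w : ι → GForm V A) (w' : GForm V A) :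
    wedgeG (∑ i ∈ s, w i) w' = ∑ i ∈ s, wedgeG (w i) w' := by
  classical
  induction s using Finset.induction_on with
  | empty => rw [sum_empty, sum_empty, wedgeG_zero_left]
  | insert a s ha ih => rw [sum_insert ha, sum_insert ha, wedgeG_add_left, ih]

/-- The shuffle wedge of graded forms commutes with finite sums on the right. [folklore] -/
theorem wedgeG_sum_right {ι : Type*} (s : Finset ι) (w : GForm V A) (w' : ι → GForm V A) :
    wedgeG w (∑ i ∈ s, w' i) = ∑ i ∈ s, wedgeG w (w' i) := by
  classical
  induction s using Finset.induction_on with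
  | empty => rw [sum_empty, sum_empty, wedgeG_zero_right]
  | insert a s ha ih => rw [sum_insert ha, sum_insert ha, wedgeG_add_right, ih]

/-- **The wedge of homogeneous elements**: `of k η ∧ of l ψ = of (k + l) (η ∧ ψ)`. [folklore] -/
theorem wedgeG_of_of (k l : ℕ) (η : V [⋀^Fin k]→L[ℝ] A) (ψ : V [⋀^Fin l]→L[ℝ] A) :
    wedgeG (of k η) (of l ψ) = of (k + l) (η.wedge ψ) := by
  funext n
  rw [wedgeG_apply]
  rcases eq_or_ne n (k + l) with rfl | hne
  · rw [of_apply_self, sum_eq_single (k, l)]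
    · rw [dif_pos rfl, of_apply_self, of_apply_self]; rfl
    · rintro ⟨a, b⟩ hab hne
      have h : a + b = k + l := mem_antidiagonal.1 hab
      rw [dif_pos h]
      rcases eq_or_ne a k with rfl | ha
      · have hb : b ≠ l := fun hb ↦ hne (by rw [hb])
        rw [of_apply_of_ne hb, ContinuousAlternatingMap.wedge_zero, ContinuousAlternatingMap.domDomCongr_zero]
      · rw [of_apply_of_ne ha, ContinuousAlternatingMap.zero_wedge, ContinuousAlternatingMap.domDomCongr_zero]
    · intro h; exact absurd (mem_antidiagonal.2 rfl : (k, l) ∈ antidiagonal (k + l)) h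
  · rw [of_apply_of_ne hne]
    refine sum_eq_zero ?_
    rintro ⟨a, b⟩ hab
    have h : a + b = n := mem_antidiagonal.1 hab
    rw [dif_pos h]
    rcases eq_or_ne a k with rfl | ha
    · have hb : b ≠ l := fun hb ↦ hne (by rw [← h, hb])
      rw [of_apply_of_ne hb, ContinuousAlternatingMap.wedge_zero, ContinuousAlternatingMap.domDomCongr_zero]
    · rw [of_apply_of_ne ha, ContinuousAlternatingMap.zero_wedge, ContinuousAlternatingMap.domDomCongr_zero]

/-- **`(θ ∧ w) ∧ w' = θ ∧ (w ∧ w')`** (associativity across the two wedges, Warner (1983), 2.6;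
componentwise the tree's `wedgeOne_wedge_eq`). [cite: Warner1983, 2.6] -/
theorem wedgeG_wedgeOneG_left (θ : V →L[ℝ] ℝ) (w w' : GForm V A) :
    wedgeG (wedgeOneG θ w) w' = wedgeOneG θ (wedgeG w w') := by
  funext n
  cases n with
  | zero =>
    rw [wedgeOneG_apply_zero, wedgeG_apply, Nat.antidiagonal_zero, sum_singleton,
      wedgeG_summand (p := (0, 0)) (n := 0) rfl]
    change ((wedgeOneG θ w 0).wedge (w' 0)).domDomCongr _ = 0
    rw [wedgeOneG_apply_zero, ContinuousAlternatingMap.zero_wedge, ContinuousAlternatingMap.domDomCongr_zero]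
  | succ n =>
    rw [wedgeOneG_apply_succ, wedgeG_apply, wedgeG_apply, Nat.sum_antidiagonal_succ, wedgeOne_sum]
    rw [dif_pos (Nat.zero_add _)]
    change ((wedgeOneG θ w 0).wedge (w' (n + 1))).domDomCongr _ + _ = _
    rw [wedgeOneG_apply_zero, ContinuousAlternatingMap.zero_wedge, ContinuousAlternatingMap.domDomCongr_zero,
      zero_add]
    refine sum_congr rfl fun p hp ↦ ?_
    have h : p.1 + p.2 = n := mem_antidiagonal.1 hp
    rw [dif_pos (by omega : p.1 + 1 + p.2 = n + 1), dif_pos h, wedgeOneG_apply_succ, wedgeOne_wedge_eq,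
      domDomCongr_finCongr_trans, wedgeOne_domDomCongr_finCongr]

/-- **`w ∧ (θ ∧ w') = θ ∧ ((negDeg w) ∧ w')`** (graded commutativity, Warner (1983), 2.6;
componentwise `wedge_wedgeOne`). [cite: Warner1983, 2.6] -/
theorem wedgeG_wedgeOneG_right (θ : V →L[ℝ] ℝ) (w w' : GForm V A) :
    wedgeG w (wedgeOneG θ w') = wedgeOneG θ (wedgeG (negDeg w) w') := by
  funext n
  cases n with
  | zero =>
    rw [wedgeOneG_apply_zero, wedgeG_apply, Nat.antidiagonal_zero, sum_singleton,
      wedgeG_summand (p := (0, 0)) (n := 0) rfl]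
    change ((w 0).wedge (wedgeOneG θ w' 0)).domDomCongr _ = 0
    rw [wedgeOneG_apply_zero, ContinuousAlternatingMap.wedge_zero, ContinuousAlternatingMap.domDomCongr_zero]
  | succ n =>
    rw [wedgeOneG_apply_succ, wedgeG_apply, wedgeG_apply, Nat.sum_antidiagonal_succ', wedgeOne_sum]
    rw [dif_pos (Nat.add_zero _)]
    change ((w (n + 1)).wedge (wedgeOneG θ w' 0)).domDomCongr _ + _ = _
    rw [wedgeOneG_apply_zero, ContinuousAlternatingMap.wedge_zero, ContinuousAlternatingMap.domDomCongr_zero,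
      zero_add]
    refine sum_congr rfl fun p hp ↦ ?_
    have h : p.1 + p.2 = n := mem_antidiagonal.1 hp
    rw [dif_pos (by omega : p.1 + (p.2 + 1) = n + 1), dif_pos h, wedgeOneG_apply_succ, wedge_wedgeOne,
      negDeg_apply, ContinuousAlternatingMap.wedge_smul_left, domDomCongr_finCongr_smul,
      domDomCongr_finCongr_smul, wedgeOne_smul, wedgeOne_domDomCongr_finCongr]

/-- `of k η ∧ (θ ∧ w') = (-1)^k θ ∧ (of k η ∧ w')`. [cite: Warner1983, 2.6] -/
theorem wedgeG_of_wedgeOneG_right (k : ℕ) (η : V [⋀^Fin k]→L[ℝ] A) (θ : V →L[ℝ] ℝ) (w' : GForm V A) :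
    wedgeG (of k η) (wedgeOneG θ w') = ((-1 : ℝ) ^ k) • wedgeOneG θ (wedgeG (of k η) w') := by
  rw [wedgeG_wedgeOneG_right, negDeg_of, wedgeG_smul_left, map_smul]

variable {ι : Type*} (θ θ' : ι → V →L[ℝ] ℝ)

/-- **`(L_s w) ∧ w' = L_s (w ∧ w')`** (pairs of covectors are central). [cite: Warner1983, 2.6] -/
theorem wedgeG_lefG_left (s : Finset ι) (w w' : GForm V A) :
    wedgeG (lefG θ θ' s w) w' = lefG θ θ' s (wedgeG w w') := by
  rw [lefG_apply, lefG_apply, wedgeG_sum_left]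
  exact sum_congr rfl fun a _ ↦ by rw [wedgeG_wedgeOneG_left, wedgeG_wedgeOneG_left]

/-- **`w ∧ (L_s w') = L_s (w ∧ w')`** (pairs of covectors are central). [cite: Warner1983, 2.6] -/
theorem wedgeG_lefG_right (s : Finset ι) (w w' : GForm V A) :
    wedgeG w (lefG θ θ' s w') = lefG θ θ' s (wedgeG w w') := by
  rw [lefG_apply, lefG_apply, wedgeG_sum_right]
  exact sum_congr rfl fun a _ ↦ by
    rw [wedgeG_wedgeOneG_right, wedgeG_wedgeOneG_right, negDeg_negDeg]

/-- `(L_s^r w) ∧ w' = L_s^r (w ∧ w')`. [cite: Warner1983, 2.6] -/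
theorem wedgeG_lefG_pow_left (s : Finset ι) (r : ℕ) (w w' : GForm V A) :
    wedgeG ((lefG θ θ' s ^ r) w) w' = (lefG θ θ' s ^ r) (wedgeG w w') := by
  induction r generalizing w with
  | zero => rfl
  | succ r ih => rw [pow_succ, Module.End.mul_apply, Module.End.mul_apply, ih, wedgeG_lefG_left]

/-- `w ∧ (L_s^r w') = L_s^r (w ∧ w')`. [cite: Warner1983, 2.6] -/
theorem wedgeG_lefG_pow_right (s : Finset ι) (r : ℕ) (w w' : GForm V A) :
    wedgeG w ((lefG θ θ' s ^ r) w') = (lefG θ θ' s ^ r) (wedgeG w w') := by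
  induction r generalizing w' with
  | zero => rfl
  | succ r ih => rw [pow_succ, Module.End.mul_apply, Module.End.mul_apply, ih, wedgeG_lefG_right]

/-- Pull-back is multiplicative for the shuffle wedge of graded forms (Warner (1983), 2.22).
[cite: Warner1983, 2.22] -/
theorem pullG_wedgeG {W : Type*} [NormedAddCommGroup W] [NormedSpace ℝ W] (T : W →L[ℝ] V)
    (w w' : GForm V A) : pullG T (wedgeG w w') = wedgeG (pullG T w) (pullG T w') := by
  funext n
  rw [pullG_apply, wedgeG_apply, wedgeG_apply]
  have : (∑ p ∈ antidiagonal n, if h : p.1 + p.2 = n then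
      ((w p.1).wedge (w' p.2)).domDomCongr (finCongr h) else 0).compContinuousLinearMap T =
      ∑ p ∈ antidiagonal n, (if h : p.1 + p.2 = n then
        ((w p.1).wedge (w' p.2)).domDomCongr (finCongr h) else 0).compContinuousLinearMap T := by
    ext v; simp
  rw [this]
  refine sum_congr rfl fun p hp ↦ ?_
  have h : p.1 + p.2 = n := mem_antidiagonal.1 hp
  rw [dif_pos h, dif_pos h, pullG_apply, pullG_apply, domDomCongr_finCongr_compContinuousLinearMap,
    ContinuousAlternatingMap.wedge_compContinuousLinearMap]

end Wedge

/-! ### The shuffle wedge of `ℂ`-valued graded forms: conjugation and complex scalars -/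

section WedgeComplex

/-- **Conjugation is multiplicative** for the shuffle wedge of graded forms. [folklore] -/
theorem conjG_wedgeG (w w' : GForm V ℂ) : conjG (wedgeG w w') = wedgeG (conjG w) (conjG w') := by
  funext n
  rw [conjG_apply, wedgeG_apply, wedgeG_apply, conj_sum]
  refine sum_congr rfl fun p hp ↦ ?_
  have h : p.1 + p.2 = n := mem_antidiagonal.1 hp
  rw [dif_pos h, dif_pos h, conjG_apply, conjG_apply, conjForm_domDomCongr_finCongr, conj_wedge]

/-- Complex scalars pass through the shuffle wedge of graded forms on the left. [folklore] -/
theorem wedgeG_smul_left_complex (c : ℂ) (w w' : GForm V ℂ) : wedgeG (c • w) w' = c • wedgeG w w' := by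
  funext n
  rw [Pi.smul_apply, wedgeG_apply, wedgeG_apply, smul_sum]
  refine sum_congr rfl fun p hp ↦ ?_
  have h : p.1 + p.2 = n := mem_antidiagonal.1 hp
  rw [dif_pos h, dif_pos h, Pi.smul_apply, wedge_smul_left_complex, domDomCongr_finCongr_smul]

/-- Complex scalars pass through the shuffle wedge of graded forms on the right. [folklore] -/
theorem wedgeG_smul_right_complex (c : ℂ) (w w' : GForm V ℂ) : wedgeG w (c • w') = c • wedgeG w w' := by
  funext n
  rw [Pi.smul_apply, wedgeG_apply, wedgeG_apply, smul_sum]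
  refine sum_congr rfl fun p hp ↦ ?_
  have h : p.1 + p.2 = n := mem_antidiagonal.1 hp
  rw [dif_pos h, dif_pos h, Pi.smul_apply, wedge_smul_right_complex, domDomCongr_finCongr_smul]

end WedgeComplex

/-! ### Homogeneity -/

section Homog

/-- A graded form is **homogeneous of degree `m`** if its other components vanish. [folklore] -/
def IsHomog (m : ℕ) (w : GForm V F) : Prop := ∀ m' ≠ m, w m' = 0

namespace IsHomog

variable {m : ℕ} {w w' : GForm V F}

/-- A homogeneous graded form is `of` its only component. [folklore] -/
theorem eq_of (h : IsHomog m w) : w = of m (w m) := by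
  funext m'
  rcases eq_or_ne m' m with rfl | hm
  · rw [of_apply_self]
  · rw [of_apply_of_ne hm, h m' hm]

/-- `of m η` is homogeneous of degree `m`. [folklore] -/
theorem of (m : ℕ) (η : V [⋀^Fin m]→L[ℝ] F) : IsHomog m (GForm.of m η) :=
  fun _ hm ↦ of_apply_of_ne hm η

/-- `0` is homogeneous of every degree. [folklore] -/
theorem zero (m : ℕ) : IsHomog m (0 : GForm V F) := fun _ _ ↦ rfl

/-- Homogeneity is stable under addition. [folklore] -/
theorem add (h : IsHomog m w) (h' : IsHomog m w') : IsHomog m (w + w') :=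
  fun m' hm ↦ by rw [Pi.add_apply, h m' hm, h' m' hm, add_zero]

/-- Homogeneity is stable under scalars. [folklore] -/
theorem smul {R : Type*} [Monoid R] [DistribMulAction R F] [ContinuousConstSMul R F]
    [SMulCommClass ℝ R F] (h : IsHomog m w) (c : R) : IsHomog m (c • w) :=
  fun m' hm ↦ by rw [Pi.smul_apply, h m' hm, smul_zero]

/-- Homogeneity is stable under negation. [folklore] -/
theorem neg (h : IsHomog m w) : IsHomog m (-w) :=
  fun m' hm ↦ by rw [Pi.neg_apply, h m' hm, neg_zero]

/-- Homogeneity is stable under subtraction. [folklore] -/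
theorem sub (h : IsHomog m w) (h' : IsHomog m w') : IsHomog m (w - w') := by
  rw [sub_eq_add_neg]; exact h.add h'.neg

/-- Homogeneity is stable under finite sums. [folklore] -/
theorem sum {ι : Type*} (s : Finset ι) {w : ι → GForm V F} (h : ∀ i ∈ s, IsHomog m (w i)) :
    IsHomog m (∑ i ∈ s, w i) := by
  classical
  induction s using Finset.induction_on with
  | empty => rw [sum_empty]; exact zero m
  | insert a s ha ih =>
    rw [sum_insert ha]
    exact (h a (mem_insert_self a s)).add (ih fun i hi ↦ h i (mem_insert_of_mem hi))

/-- A wedge by a covector raises the degree by one. [folklore] -/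
theorem wedgeOneG (h : IsHomog m w) (θ : V →L[ℝ] ℝ) : IsHomog (m + 1) (GForm.wedgeOneG θ w) := by
  rw [h.eq_of, wedgeOneG_of]; exact of _ _

/-- An interior product lowers the degree by one. [folklore] -/
theorem curryLeftG (h : IsHomog (m + 1) w) (x : V) : IsHomog m (GForm.curryLeftG x w) := by
  rw [h.eq_of, curryLeftG_of_succ]; exact of _ _

/-- Interior products kill homogeneous graded forms of degree `0`. [folklore] -/
theorem curryLeftG_eq_zero (h : IsHomog 0 w) (x : V) : GForm.curryLeftG x w = 0 := by
  rw [h.eq_of, curryLeftG_of_zero]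

/-- The Lefschetz-type operators raise the degree by two. [folklore] -/
theorem lefG {ι : Type*} (θ θ' : ι → V →L[ℝ] ℝ) (s : Finset ι) (h : IsHomog m w) :
    IsHomog (m + 2) (GForm.lefG θ θ' s w) := by
  rw [h.eq_of, lefG_of]; exact of _ _

/-- The powers of the Lefschetz-type operators raise the degree by `2r`. [folklore] -/
theorem lefG_pow {ι : Type*} (θ θ' : ι → V →L[ℝ] ℝ) (s : Finset ι) (r : ℕ) (h : IsHomog m w) :
    IsHomog (m + 2 * r) ((GForm.lefG θ θ' s ^ r) w) := by
  rw [h.eq_of]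
  exact fun m' hm ↦ lefG_pow_of_apply_of_ne θ θ' s r hm _

/-- Pull-backs preserve homogeneity. [folklore] -/
theorem pullG {W : Type*} [NormedAddCommGroup W] [NormedSpace ℝ W] (T : W →L[ℝ] V) (h : IsHomog m w) :
    IsHomog m (GForm.pullG T w) := by
  intro m' hm
  rw [pullG_apply, h m' hm]
  ext v; simp

/-- A homogeneous graded form vanishes iff its distinguished component does. [folklore] -/
theorem eq_zero_iff (h : IsHomog m w) : w = 0 ↔ w m = 0 := by
  refine ⟨fun h0 ↦ by rw [h0]; rfl, fun h0 ↦ ?_⟩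
  rw [h.eq_of, h0, of_zero]

end IsHomog

/-- The shuffle wedge adds degrees. [folklore] -/
theorem IsHomog.wedgeG {k l : ℕ} {w w' : GForm V A} (h : IsHomog k w) (h' : IsHomog l w') :
    IsHomog (k + l) (GForm.wedgeG w w') := by
  rw [h.eq_of, h'.eq_of, wedgeG_of_of]; exact IsHomog.of _ _

/-- Conjugation preserves homogeneity. [folklore] -/
theorem IsHomog.conjG {m : ℕ} {w : GForm V ℂ} (h : IsHomog m w) : IsHomog m (GForm.conjG w) :=
  fun m' hm ↦ by rw [conjG_apply, h m' hm, conj_zero]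

end Homog

end GForm

end Literature.LinearAlgebra.Alternating

end
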